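import Literature.Barriers.FinalStateConjecture.KleinGordonModeConstruction
import Literature.Barriers.FinalStateConjecture.KleinGordonSuperradiantInstabilitySeparation
import HarnessLib

/-!
# Barrier catalogue `FinalStateConjecture`: Shlapentokh-Rothman's unstable Klein–Gordon modes —
# proof of Carter separation on the Kerr–Schild leaf (`CarterSeparationKSLeaf_holds`)
(`Literature/Barriers/FinalStateConjecture/`, D-0021, D-0014; family `gr`; namespace
`Literature.Barriers.FinalStateConjecture`)

`KleinGordonModeConstruction.lean` vendors the named fact `CarterSeparationKSLeaf`: if `S` solves
the angular ODE (2.1) of Shlapentokh-Rothman (CMP 329 (2014), §2) on `(0, π)`, `Y` is the smooth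
degree-`0` extension of `e^{imφ}S(θ)`, and `R` solves the radial ODE (2.2) on `(r₊, ∞)`, then the
Kerr–Schild-leaf profile `Φ(y) = e^{i(ω(t̄ − r) − mφ̄)} R(r) · Y(ℓ⃗(0, y))`
(`ksProfile a (ksRadial M a ω m R) Y`) solves the reduced equation `P_ω Φ = μ² Φ`
(`reducedWaveOp`) on the leaf `Kerr.slice a r₊` — Carter's separability of the Klein–Gordon
operator on Kerr (Carter, CMP 10 (1968)), as printed in SR §2 ("In order for `ψ` to satisfy the
Klein–Gordon equation, `S_{ml}` and `R` must satisfy (2.1), (2.2)") and transcribed to the ingoing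
chart of the prelude. This file proves it (`CarterSeparationKSLeaf_holds`):

1. **the leaf radial ODE** (`ksRadial_ode`): the leaf radial factor
   `g = e^{i(ω(t̄ − r) − mφ̄)} R` solves
   `Δ g'' + Δ' g' + 2i(am − 2Mωr) g' + (ω²(r² + 2Mr) − 2iωM − λ − μ²r²) g = 0` on `(r₊, ∞)` — the
   conjugation of (2.2) by the phase (`dt̄/dr = (r² + a²)/Δ`, `dφ̄/dr = a/Δ`, §1.2.1), obtained from
   `ingoingRadial_of_radialODE` (`KleinGordonSuperradiantInstabilityInputs.lean`) with
   `f = e^{i(ωt̄ − mφ̄)} R`;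
2. **the profile is separated along Kerr's ingoing spheroidal coordinates** `Y_a(r, θ, φ)`
   (`Kerr.kerrStar`): `Φ(Y_a(s, t, p)) = g(s) e^{imp} S(t)` for `s > 0`, `t ∈ (0, π)`
   (`ksProfile_kerrStar`: `r(Y_a) = s`, `ℓ⃗(Y_a) = n̂(t, p)`), an `IsSeparatedNear` datum of
   `KleinGordonSuperradiantInstabilitySeparation.lean`;
3. **assembly off the axis** (`reducedWaveOp_ksProfile_kerrStar`): `reducedWaveOp_eq_mass_of_separated`
   (loc. cit.: `reducedWaveOp_kerrStar`, i.e. `Σ P_ω Φ` in the coordinates, `Σ = r² + a² cos² θ`,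
   recombined with the angular ODE (2.1) — expanded by `deriv_sin_mul_deriv` — and the leaf radial
   ODE to `Σ P_ω Φ = μ² Σ Φ`) at `Y_a(r, θ, φ)`, `r > r₊`, `θ ∈ (0, π)`;
4. **the axis** by continuity (`Kerr.eqOn_slice_of_offAxis`, `continuousOn_reducedWaveOp`).

## References

* Y. Shlapentokh-Rothman, *Exponentially growing finite energy solutions for the Klein–Gordon
  equation on sub-extremal Kerr spacetimes*, Comm. Math. Phys. 329 (2014) 859–891,
  arXiv:1302.3448: §1.2.1 (Kerr-star coordinates, `t̄`, `φ̄`), §2 ((2.1)–(2.3)) (held copy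
  `paper:arxiv-1302.3448`, p. 4 and p. 7) (key `ShlapentokhRothman2014KleinGordon`).
* B. Carter, *Hamilton–Jacobi and Schrödinger separable solutions of Einstein's equations*, Comm.
  Math. Phys. 10 (1968) 280–310 (key `Carter1968`).
-/

noncomputable section

open Set Filter Topology
open scoped Real ContDiff

namespace Literature.Barriers.FinalStateConjecture

open Literature.Geometry.Lorentzian Literature.Geometry.Lorentzian.Kerr

/-! ### 1. The leaf radial factor: smoothness and the conjugated radial ODE -/

section Radial

variable {M a : ℝ}

/-- The leaf phase `e^{i(ω(t̄ − r) − mφ̄)}` is `C^∞` on `(r₊, ∞)` (so are `t̄`, `φ̄`). [folklore] -/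
theorem contDiffOn_ksPhase (hMa : Kerr.IsSubextremal M a) (w : ℂ) (m : ℤ) {n : WithTop ℕ∞} :
    ContDiffOn ℝ n (ksPhase M a w m) (Ioi (Kerr.rPlus M a)) := by
  have hof : ContDiff ℝ n (fun x : ℝ ↦ (x : ℂ)) := Complex.ofRealCLM.contDiff
  have h1 : ContDiffOn ℝ n (fun r ↦ ((Kerr.starTime M a r - r : ℝ) : ℂ)) (Ioi (Kerr.rPlus M a)) :=
    hof.comp_contDiffOn ((Kerr.contDiffOn_starTime hMa).sub contDiffOn_id)
  have h2 : ContDiffOn ℝ n (fun r ↦ ((Kerr.starAngle M a r : ℝ) : ℂ)) (Ioi (Kerr.rPlus M a)) :=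
    hof.comp_contDiffOn (Kerr.contDiffOn_starAngle hMa)
  exact (contDiffOn_const.mul ((contDiffOn_const.mul h1).sub (contDiffOn_const.mul h2))).cexp

/-- The leaf radial factor `e^{i(ω(t̄ − r) − mφ̄)} R` is `Cⁿ` on `(r₊, ∞)` when `R` is. [folklore] -/
theorem contDiffOn_ksRadial (hMa : Kerr.IsSubextremal M a) (w : ℂ) (m : ℤ) {n : WithTop ℕ∞}
    {R : ℝ → ℂ} (hR : ContDiffOn ℝ n R (Ioi (Kerr.rPlus M a))) :
    ContDiffOn ℝ n (ksRadial M a w m R) (Ioi (Kerr.rPlus M a)) :=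
  (contDiffOn_ksPhase hMa w m).mul hR

/-- **The leaf radial ODE.** If `R` solves the radial ODE (2.2), `Δ(ΔR')' = V_μ R` on `(r₊, ∞)`
(`IsRadialSolution`), then the leaf radial factor `g = e^{i(ω(t̄ − r) − mφ̄)} R` (`ksRadial`) solves,
at every `r > r₊`,
`Δ g'' + (2r − 2M) g' + (2iam − 4iωMr) g' + (ω²(r² + 2Mr) − 2iωM − λ − μ²r²) g = 0`
(`Δ = r² − 2Mr + a²`): the radial ODE in the ingoing chart `(t_KS, r, θ, φ*)`, i.e. (2.2) conjugated
by the phase, `dt̄/dr = (r² + a²)/Δ`, `dφ̄/dr = a/Δ` (SR §1.2.1). From `ingoingRadial_of_radialODE`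
with `f = e^{i(ωt̄ − mφ̄)} R` (so that `R = e^{−i(ωt̄ − mφ̄)} f` and `e^{−iωr} f = g`).
[cite: ShlapentokhRothman2014KleinGordon, §1.2.1 and §2 (2.2)–(2.3)] -/
theorem ksRadial_ode (hMa : Kerr.IsSubextremal M a) {w Λ : ℂ} {m : ℤ} {μ : ℝ} {R : ℝ → ℂ}
    (hR : IsRadialSolution M a w m Λ μ R) {r : ℝ} (hr : Kerr.rPlus M a < r) :
    (r ^ 2 - 2 * M * r + a ^ 2 : ℂ) * deriv (deriv (ksRadial M a w m R)) r
      + (2 * r - 2 * M : ℂ) * deriv (ksRadial M a w m R) r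
      + (2 * Complex.I * a * m - 4 * Complex.I * w * M * r) * deriv (ksRadial M a w m R) r
      + (w ^ 2 * (r ^ 2 + 2 * M * r) - 2 * Complex.I * w * M - Λ - μ ^ 2 * r ^ 2) *
          ksRadial M a w m R r = 0 := by
  -- the horizon-regularised factor `f = e^{i(ωt̄ − mφ̄)} R` (here merely a device: no regularity at
  -- `r₊` is claimed or needed)
  set f : ℝ → ℂ := fun s ↦ Complex.exp (Complex.I * (w * (Kerr.starTime M a s : ℂ) -
    (m : ℂ) * (Kerr.starAngle M a s : ℂ))) * R s with hf
  have hI : Ioi (Kerr.rPlus M a) ∈ 𝓝 r := Ioi_mem_nhds hr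
  have hΔ : ∀ᶠ s in 𝓝 r, s ^ 2 - 2 * M * s + a ^ 2 ≠ 0 := by
    filter_upwards [hI] with s hs
    exact (Kerr.delta_pos hMa.le hs).ne'
  have ht : ∀ᶠ s in 𝓝 r,
      HasDerivAt (Kerr.starTime M a) ((s ^ 2 + a ^ 2) / (s ^ 2 - 2 * M * s + a ^ 2)) s := by
    filter_upwards [hI] with s hs
    exact Kerr.hasDerivAt_starTime hMa hs
  have hp : ∀ᶠ s in 𝓝 r, HasDerivAt (Kerr.starAngle M a) (a / (s ^ 2 - 2 * M * s + a ^ 2)) s := by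
    filter_upwards [hI] with s hs
    exact Kerr.hasDerivAt_starAngle hMa hs
  have hRd : ∀ᶠ s in 𝓝 r, DifferentiableAt ℝ R s := by
    filter_upwards [hI] with s hs
    exact (hR.1.contDiffAt (Ioi_mem_nhds hs)).differentiableAt (by simp)
  have hRC : ContDiffAt ℝ ∞ R r := hR.1.contDiffAt hI
  have hR2 : DifferentiableAt ℝ (deriv R) r :=
    differentiableAt_deriv_of_contDiffAt (hRC.of_le (WithTop.coe_le_coe.2 le_top))
  have hfR : ∀ᶠ s in 𝓝 r, R s = Complex.exp (-Complex.I * (w * (Kerr.starTime M a s : ℂ) -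
      (m : ℂ) * (Kerr.starAngle M a s : ℂ))) * f s := by
    refine Filter.Eventually.of_forall fun s ↦ ?_
    simp only [hf]
    rw [← mul_assoc, ← Complex.exp_add, neg_mul, neg_add_cancel, Complex.exp_zero, one_mul]
  -- `f` is `C²` at `r`
  have hof : ContDiff ℝ 2 (fun x : ℝ ↦ (x : ℂ)) := Complex.ofRealCLM.contDiff
  have hst : ContDiffAt ℝ 2 (fun s ↦ (Kerr.starTime M a s : ℂ)) r :=
    hof.contDiffAt.comp r ((Kerr.contDiffOn_starTime hMa).contDiffAt hI)
  have hsa : ContDiffAt ℝ 2 (fun s ↦ (Kerr.starAngle M a s : ℂ)) r :=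
    hof.contDiffAt.comp r ((Kerr.contDiffOn_starAngle hMa).contDiffAt hI)
  have hfC : ContDiffAt ℝ 2 f r :=
    (contDiffAt_const.mul ((contDiffAt_const.mul hst).sub (contDiffAt_const.mul hsa))).cexp.mul
      (hRC.of_le (WithTop.coe_le_coe.2 le_top))
  -- the printed radial ODE (2.2) at `r`, in the polynomial form of `ingoingRadial_of_radialODE`
  have hODE : ((r ^ 2 - 2 * M * r + a ^ 2 : ℝ) : ℂ) *
        deriv (fun s : ℝ ↦ ((s ^ 2 - 2 * M * s + a ^ 2 : ℝ) : ℂ) * deriv R s) r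
      - (-(r ^ 2 + a ^ 2) ^ 2 * w ^ 2 + 4 * M * a * m * r * w - a ^ 2 * m ^ 2
          + (r ^ 2 - 2 * M * r + a ^ 2) * (Λ + a ^ 2 * w ^ 2 + μ ^ 2 * r ^ 2) : ℂ) * R r = 0 := by
    have h := hR.2 r hr
    simp only [kgRadialPotential, Kerr.delta] at h
    push_cast at h ⊢
    linear_combination h
  have key := ingoingRadial_of_radialODE (m := m) (lam := Λ) (μ := μ) hΔ ht hp hRd hR2 hfR hfC hODE
  -- `e^{−iωs} f = g`
  have hu : (fun s : ℝ ↦ Complex.exp (-Complex.I * w * (s : ℂ)) * f s) = ksRadial M a w m R := by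
    funext s
    simp only [hf, ksRadial, ksPhase]
    rw [← mul_assoc, ← Complex.exp_add]
    congr 2
    push_cast
    ring
  have hur : Complex.exp (-Complex.I * w * (r : ℂ)) * f r = ksRadial M a w m R r := congrFun hu r
  rw [hu, hur] at key
  exact key

end Radial

/-! ### 2. Separation off the axis, and the axis by continuity -/

/-- **Carter separation at an off-axis point of the leaf.** For sub-extremal `(M, a)`, `S` solving
(2.1) on `(0, π)`, `Y` its smooth spherical extension and `R` solving (2.2) on `(r₊, ∞)`, the leaf
profile `Φ = ksProfile a (ksRadial M a ω m R) Y` satisfies `P_ω Φ = μ² Φ` at `Y_a(r, θ, φ)` for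
`r > r₊`, `θ ∈ (0, π)`: along `Y_a` the profile is the separated function `g(s) e^{imp} S(t)`
(`s > 0`, `t ∈ (0, π)`; `ksProfile_kerrStar`), `g = ksRadial M a ω m R`, so
`reducedWaveOp_eq_mass_of_separated` applies with the angular ODE (2.1) at `θ` (expanded,
`deriv_sin_mul_deriv`) and the leaf radial ODE at `r` (`ksRadial_ode`). SR, CMP 329 (2014), §2
(2.1)–(2.2); Carter, CMP 10 (1968). [cite: ShlapentokhRothman2014KleinGordon, §2 (2.1)–(2.2); Carter1968] -/
theorem reducedWaveOp_ksProfile_kerrStar {M a : ℝ} (hMa : Kerr.IsSubextremal M a) {w Λ : ℂ}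
    {m : ℤ} {μ : ℝ} {S : ℝ → ℂ} {Y : E3 → ℂ} {R : ℝ → ℂ}
    (hS : IsAngularSolution a w μ m Λ S) (hY : IsSphericalExtension m S Y)
    (hR : IsRadialSolution M a w m Λ μ R) {r θ : ℝ} (hr : Kerr.rPlus M a < r) (hθ : θ ∈ Ioo 0 π)
    (φ : ℝ) :
    reducedWaveOp M a w (ksProfile a (ksRadial M a w m R) Y) (kerrStar a r θ φ) =
      μ ^ 2 * ksProfile a (ksRadial M a w m R) Y (kerrStar a r θ φ) := by
  set g : ℝ → ℂ := ksRadial M a w m R with hg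
  set Φ : E3 → ℂ := ksProfile a g Y with hΦdef
  have hr0 : 0 < r := hMa.rPlus_pos.trans hr
  have hsin : Real.sin θ ≠ 0 := (Real.sin_pos_of_pos_of_lt_pi hθ.1 hθ.2).ne'
  -- smoothness of the factors and of the profile
  have hgs : ContDiffOn ℝ ∞ g (Ioi (Kerr.rPlus M a)) := contDiffOn_ksRadial hMa w m hR.1
  have hΦs : ContDiffOn ℝ ∞ Φ (Kerr.slice a (Kerr.rPlus M a)) := contDiffOn_ksProfile hgs hY.1
  have hmem : kerrStar a r θ φ ∈ Kerr.slice a (Kerr.rPlus M a) :=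
    Kerr.kerrStar_mem_slice (max_lt hr hr0) θ φ
  have hΦ2 : ContDiffAt ℝ 2 Φ (kerrStar a r θ φ) :=
    (hΦs.contDiffAt ((Kerr.slice a (Kerr.rPlus M a)).isOpen.mem_nhds hmem)).of_le
      (WithTop.coe_le_coe.2 le_top)
  have hgC : ContDiffAt ℝ ∞ g r := hgs.contDiffAt (Ioi_mem_nhds hr)
  -- the profile is separated along `Y_a` near `(r, θ, φ)`: `Φ(Y_a(s, t, p)) = g(s) e^{imp} S(t)` for
  -- `s > 0`, `t ∈ (0, π)` (`ksProfile_kerrStar`, i.e. `r(Y_a) = s`, `ℓ⃗(Y_a) = n̂(t, p)`)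
  have hsep : IsSeparatedNear (fun s t p ↦ Φ (kerrStar a s t p)) g S m (Ioi 0) (Ioo 0 π) univ
      r θ φ :=
    { hA := Ioi_mem_nhds hr0
      hB := isOpen_Ioo.mem_nhds hθ
      hC := univ_mem
      eq := fun s hs t ht p _ ↦ by
        show Φ (kerrStar a s t p) = g s * (azPhase m p * S t)
        rw [hΦdef, ksProfile_kerrStar a g Y hs t p, hY.2.2 t ht p, azPhase]
        push_cast
        ring
      hu := hgC.of_le (WithTop.coe_le_coe.2 le_top)
      hS := (hS.1.contDiffAt (isOpen_Ioo.mem_nhds hθ)).of_le (WithTop.coe_le_coe.2 le_top) }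
  -- the angular ODE (2.1) at `θ`, expanded, and the leaf radial ODE at `r`
  have hSd : DifferentiableAt ℝ (deriv S) θ := differentiableAt_deriv_of_contDiffAt hsep.hS
  have hang : (Real.cos θ * deriv S θ + Real.sin θ * deriv (deriv S) θ) / Real.sin θ
      - ((m : ℂ) ^ 2 / (Real.sin θ : ℂ) ^ 2 - a ^ 2 * (w ^ 2 - μ ^ 2) * (Real.cos θ : ℂ) ^ 2) * S θ
      + Λ * S θ = 0 := by
    have h := hS.2 θ hθ
    rw [deriv_sin_mul_deriv hSd] at h
    push_cast at h ⊢
    linear_combination h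
  have hrad := ksRadial_ode hMa hR hr
  exact reducedWaveOp_eq_mass_of_separated (M := M) w Λ hr0 hsin hΦ2 hsep hang hrad

/-- **Carter separation on the Kerr–Schild leaf** (discharge of the named fact
`CarterSeparationKSLeaf`). Shlapentokh-Rothman, CMP 329 (2014), §2: for
`ψ = e^{−iωt}e^{imφ}S_{ml}(θ)R(r)` in Boyer–Lindquist coordinates, "in order for `ψ` to satisfy the
Klein–Gordon equation, `S_{ml}` and `R` must satisfy" (2.1) and (2.2) — Carter's separability of the
Klein–Gordon operator on Kerr (Carter, CMP 10 (1968)); here in the converse (sufficiency) direction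
and transcribed to the ingoing Kerr–Schild leaf: the profile
`Φ = e^{i(ω(t̄ − r) − mφ̄)}R(r) · Y(ℓ⃗(0, y))` solves `P_ω Φ = μ² Φ` on `Kerr.slice a r₊`. Off the axis
this is `reducedWaveOp_ksProfile_kerrStar` (every off-axis point is `Y_a(r, θ, φ)` with `r` its
Kerr–Schild radius and `θ ∈ (0, π)`, `Kerr.exists_kerrStar_eq`); on the axis it follows by
continuity of `P_ω Φ − μ² Φ` on the open slice (`continuousOn_reducedWaveOp`,
`Kerr.eqOn_slice_of_offAxis`). [cite: ShlapentokhRothman2014KleinGordon, §2 (2.1)–(2.2); Carter1968] -/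
theorem CarterSeparationKSLeaf_holds : CarterSeparationKSLeaf := by
  intro M a hMa w m Λ μ S Y R hS hY hR
  set Φ : E3 → ℂ := ksProfile a (ksRadial M a w m R) Y with hΦdef
  have hgs : ContDiffOn ℝ ∞ (ksRadial M a w m R) (Ioi (Kerr.rPlus M a)) :=
    contDiffOn_ksRadial hMa w m hR.1
  have hΦs : ContDiffOn ℝ ∞ Φ (Kerr.slice a (Kerr.rPlus M a)) := contDiffOn_ksProfile hgs hY.1
  have hG : ContinuousOn (fun y ↦ reducedWaveOp M a w Φ y - μ ^ 2 * Φ y)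
      (Kerr.slice a (Kerr.rPlus M a)) :=
    (continuousOn_reducedWaveOp w hΦs).sub (continuousOn_const.mul hΦs.continuousOn)
  have hoff : ∀ y ∈ Kerr.slice a (Kerr.rPlus M a), (y 0 ≠ 0 ∨ y 1 ≠ 0) →
      reducedWaveOp M a w Φ y - μ ^ 2 * Φ y = 0 := by
    intro y hy hax
    have hrp : Kerr.rPlus M a < Kerr.radius a (E4.ofTimeSpace 0 y) := Kerr.lt_radius_of_mem_slice hy
    have hr0 : 0 < Kerr.radius a (E4.ofTimeSpace 0 y) := Kerr.radius_pos_of_mem_slice hy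
    obtain ⟨θ, hθ, φ, hyeq⟩ := Kerr.exists_kerrStar_eq hr0 hax
    rw [← hyeq]
    exact sub_eq_zero.2 (reducedWaveOp_ksProfile_kerrStar hMa hS hY hR hrp hθ φ)
  intro y hy
  exact sub_eq_zero.1 (Kerr.eqOn_slice_of_offAxis hG hoff y hy)

/-! ### The one-hypothesis reductions: the barrier rests on `ShlapentokhRothman2014_separatedMode` -/

/-- **`ShlapentokhRothman2014_separatedMode` ⟹ `ShlapentokhRothman2014_unstableModeProfile`**
(`…of_separated` with the discharged Carter separation `CarterSeparationKSLeaf_holds`). SR, CMP 329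
(2014), Thm. 1.2 and §2. [cite: ShlapentokhRothman2014KleinGordon, Thm. 1.2 and §2] -/
theorem ShlapentokhRothman2014_unstableModeProfile.of_separatedMode
    (hM : ShlapentokhRothman2014_separatedMode) : ShlapentokhRothman2014_unstableModeProfile :=
  ShlapentokhRothman2014_unstableModeProfile.of_separated CarterSeparationKSLeaf_holds hM

/-- **`ShlapentokhRothman2014_separatedMode` ⟹ the barrier fact `KleinGordonSuperradiantInstability`**:
with Carter separation discharged, Shlapentokh-Rothman's Theorem 1.1 (vendored energy form) rests on
the single named fact `ShlapentokhRothman2014_separatedMode` (Thm. 1.2 in the printed separated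
variables: SR's analysis of the ODEs (2.1)–(2.2), App. A–C and §4). SR, CMP 329 (2014), Thm. 1.1
from Thm. 1.2. [cite: ShlapentokhRothman2014KleinGordon, Thm. 1.1 and Thm. 1.2] -/
theorem KleinGordonSuperradiantInstability.of_separatedMode
    (hM : ShlapentokhRothman2014_separatedMode) : KleinGordonSuperradiantInstability :=
  KleinGordonSuperradiantInstability.of_separated CarterSeparationKSLeaf_holds hM

end Literature.Barriers.FinalStateConjecture

end
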